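import Summits.AtomisticToContinuum.Crystallization.Theorems.ExcessDecayLiouvilleCoarseGrainsPinSums

/-!
# Certified hcp lattice sums: cubes, shells and the tail bound — stub `stub_pinNumerics` of line `vanishing-excess-truss-rigidity` (crux `CoarseGrains`, stmt-AtomisticToContinuum-9331)

Cube truncation and the tail bound for the hcp lattice sums `S e c` (definitions in `…PinSums`):
the index cubes `[-K,K]³`, the shells `[-m,m]³ ∖ [-(m-1),m-1]³` (`24m² + 2` sites, each term
`≤ ((3/5)m²)⁻ᵉ`), the telescoping estimate `∑_{m>K} m⁻⁴ ≤ 1/(3K(K-1)(K-2))`, whence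
`∑_{[-K',K']³ ∖ [-K,K]³} term ≤ hcpSumTail e K` for all `K' ≥ K ≥ 4`, `e ≥ 3`, `c² ≥ 3/5`;
consequences: summability of `S e c`, the truncation bounds
`∑_{[-K,K]³} term ≤ S e c ≤ ∑_{[-K,K]³} term + hcpSumTail e K`, antitonicity of `S e` in `c` and `S e c ≥ 1`.
[folklore]
-/

noncomputable section

namespace Summit.AtomisticToContinuum.Crystallization.Theorems.ExcessDecayLiouvilleCoarseGrains

open Finset

/-! ## Cubes, shells and the tail bound -/

/-- Membership in the index cube. [folklore] -/
theorem hcpSum_mem_hcpSumCube {K : ℕ} {v : ℤ × ℤ × ℤ} :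
    v ∈ hcpSumCube K ↔ |v.1| ≤ K ∧ |v.2.1| ≤ K ∧ |v.2.2| ≤ K := by
  obtain ⟨k, i, j⟩ := v
  simp only [hcpSumCube, Finset.mem_product, Finset.mem_Icc, abs_le]

/-- The cubes increase. [folklore] -/
theorem hcpSumCube_mono {K K' : ℕ} (h : K ≤ K') : hcpSumCube K ⊆ hcpSumCube K' := by
  intro v hv
  rw [hcpSum_mem_hcpSumCube] at hv ⊢
  have : (K : ℤ) ≤ K' := by exact_mod_cast h
  exact ⟨hv.1.trans this, hv.2.1.trans this, hv.2.2.trans this⟩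

/-- `#[-K,K]³ = (2K+1)³`. [folklore] -/
theorem hcpSum_card_hcpSumCube (K : ℕ) : (hcpSumCube K).card = (2 * K + 1) ^ 3 := by
  simp only [hcpSumCube, Finset.card_product, Int.card_Icc]
  have : ((K : ℤ) + 1 - -(K : ℤ)).toNat = 2 * K + 1 := by omega
  rw [this]; ring

/-- Outside the cube some coordinate is large. [folklore] -/
theorem hcpSum_not_mem_hcpSumCube {K : ℕ} {v : ℤ × ℤ × ℤ} :
    v ∉ hcpSumCube K ↔ (K : ℤ) + 1 ≤ |v.1| ∨ (K : ℤ) + 1 ≤ |v.2.1| ∨ (K : ℤ) + 1 ≤ |v.2.2| := by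
  rw [hcpSum_mem_hcpSumCube]; omega

/-- A shell `[-m,m]³ ∖ [-(m-1), m-1]³` has `24 m² + 2` sites. [folklore] -/
theorem hcpSum_card_shell {m : ℕ} (hm : 1 ≤ m) :
    ((hcpSumCube m \ hcpSumCube (m - 1)).card : ℝ) = 24 * (m : ℝ) ^ 2 + 2 := by
  rw [Finset.card_sdiff_of_subset (hcpSumCube_mono (Nat.sub_le m 1)), hcpSum_card_hcpSumCube, hcpSum_card_hcpSumCube]
  obtain ⟨n, rfl⟩ : ∃ n, m = n + 1 := ⟨m - 1, by omega⟩
  simp only [Nat.add_sub_cancel]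
  have h : (2 * n + 1) ^ 3 ≤ (2 * (n + 1) + 1) ^ 3 := Nat.pow_le_pow_left (by omega) 3
  have : (2 * (n + 1) + 1) ^ 3 - (2 * n + 1) ^ 3 = 24 * (n + 1) ^ 2 + 2 := by
    zify [h]; ring
  rw [this]; push_cast; ring

/-- **Sum over one shell**: for `m ≥ 4` and `c² ≥ 3/5`,
`∑_{shell m} term ≤ (24m²+2)·((3/5)m²)⁻ᵉ`. [folklore] -/
theorem hcpSum_sum_shell_le {e : ℕ} {c : ℝ} (hc : 3 / 5 ≤ c ^ 2) {m : ℕ} (hm : 4 ≤ m) :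
    ∑ v ∈ hcpSumCube m \ hcpSumCube (m - 1), hcpSumTerm e c v ≤
      (24 * (m : ℝ) ^ 2 + 2) * ((3 / 5 * (m : ℝ) ^ 2)⁻¹) ^ e := by
  have hbound : ∀ v ∈ hcpSumCube m \ hcpSumCube (m - 1), hcpSumTerm e c v ≤ ((3 / 5 * (m : ℝ) ^ 2)⁻¹) ^ e := by
    intro v hv
    rw [Finset.mem_sdiff, hcpSum_not_mem_hcpSumCube] at hv
    apply hcpSumTerm_le_of_shell hc hm
    have h1 : ((m - 1 : ℕ) : ℤ) + 1 = m := by omega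
    rw [h1] at hv
    exact hv.2
  calc ∑ v ∈ hcpSumCube m \ hcpSumCube (m - 1), hcpSumTerm e c v
      ≤ ∑ _v ∈ hcpSumCube m \ hcpSumCube (m - 1), ((3 / 5 * (m : ℝ) ^ 2)⁻¹) ^ e := Finset.sum_le_sum hbound
    _ = (24 * (m : ℝ) ^ 2 + 2) * ((3 / 5 * (m : ℝ) ^ 2)⁻¹) ^ e := by
        rw [Finset.sum_const, nsmul_eq_mul, hcpSum_card_shell (by omega)]

/-- The shell bound in telescopable form: for `e ≥ 3`, `m ≥ K+1 ≥ 2`,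
`(24m²+2)((3/5)m²)⁻ᵉ ≤ 25 (5/3)ᵉ / ((K+1)^{2e-6} m⁴)`. [folklore] -/
theorem hcpSum_shell_bound_le {e K m : ℕ} (he : 3 ≤ e) (hK : 1 ≤ K) (hm : K + 1 ≤ m) :
    (24 * (m : ℝ) ^ 2 + 2) * ((3 / 5 * (m : ℝ) ^ 2)⁻¹) ^ e ≤
      25 * (5 / 3 : ℝ) ^ e / ((K : ℝ) + 1) ^ (2 * e - 6) * ((m : ℝ) ^ 4)⁻¹ := by
  have hm2 : (2 : ℝ) ≤ m := by exact_mod_cast (show 2 ≤ m by omega)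
  have hKm : (K : ℝ) + 1 ≤ m := by exact_mod_cast hm
  obtain ⟨d, rfl⟩ : ∃ d, e = d + 3 := ⟨e - 3, by omega⟩
  have h26 : 2 * (d + 3) - 6 = 2 * d := by omega
  rw [h26]
  have hl : (24 * (m : ℝ) ^ 2 + 2) * ((3 / 5 * (m : ℝ) ^ 2)⁻¹) ^ (d + 3) =
      (24 * (m : ℝ) ^ 2 + 2) * (5 / 3) ^ (d + 3) / ((m : ℝ) ^ 2) ^ (d + 3) := by
    rw [show ((3 : ℝ) / 5 * (m : ℝ) ^ 2)⁻¹ = 5 / 3 * ((m : ℝ) ^ 2)⁻¹ by rw [mul_inv]; norm_num,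
      mul_pow, inv_pow]
    ring
  have hr : 25 * (5 / 3 : ℝ) ^ (d + 3) / ((K : ℝ) + 1) ^ (2 * d) * ((m : ℝ) ^ 4)⁻¹ =
      25 * (5 / 3 : ℝ) ^ (d + 3) / (((K : ℝ) + 1) ^ (2 * d) * (m : ℝ) ^ 4) := by
    rw [div_mul_eq_mul_div]
    field_simp
  rw [hl, hr, div_le_div_iff₀ (by positivity) (by positivity)]
  have key : (24 * (m : ℝ) ^ 2 + 2) * (((K : ℝ) + 1) ^ (2 * d) * (m : ℝ) ^ 4) ≤
      25 * ((m : ℝ) ^ 2) ^ (d + 3) := by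
    have h1 : ((K : ℝ) + 1) ^ (2 * d) ≤ (m : ℝ) ^ (2 * d) := pow_le_pow_left₀ (by positivity) hKm _
    have h2 : ((m : ℝ) ^ 2) ^ (d + 3) = (m : ℝ) ^ (2 * d) * (m : ℝ) ^ 4 * (m : ℝ) ^ 2 := by ring
    have h25 : 24 * (m : ℝ) ^ 2 + 2 ≤ 25 * (m : ℝ) ^ 2 := by nlinarith
    have hm4 : (0 : ℝ) ≤ (m : ℝ) ^ 4 := by positivity
    rw [h2]
    calc (24 * (m : ℝ) ^ 2 + 2) * (((K : ℝ) + 1) ^ (2 * d) * (m : ℝ) ^ 4)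
        ≤ (25 * (m : ℝ) ^ 2) * ((m : ℝ) ^ (2 * d) * (m : ℝ) ^ 4) := by
          apply mul_le_mul h25 (mul_le_mul_of_nonneg_right h1 hm4) (by positivity) (by positivity)
      _ = (m : ℝ) ^ (2 * d) * (m : ℝ) ^ 4 * (m : ℝ) ^ 2 * 25 := by ring
      _ = 25 * ((m : ℝ) ^ (2 * d) * (m : ℝ) ^ 4 * (m : ℝ) ^ 2) := by ring
  calc (24 * (m : ℝ) ^ 2 + 2) * (5 / 3) ^ (d + 3) * (((K : ℝ) + 1) ^ (2 * d) * (m : ℝ) ^ 4)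
      = (5 / 3 : ℝ) ^ (d + 3) * ((24 * (m : ℝ) ^ 2 + 2) * (((K : ℝ) + 1) ^ (2 * d) * (m : ℝ) ^ 4)) := by
        ring
    _ ≤ (5 / 3 : ℝ) ^ (d + 3) * (25 * ((m : ℝ) ^ 2) ^ (d + 3)) :=
        mul_le_mul_of_nonneg_left key (by positivity)
    _ = 25 * (5 / 3) ^ (d + 3) * ((m : ℝ) ^ 2) ^ (d + 3) := by ring

/-- Elementary step of the telescoping bound. [folklore] -/
theorem hcpSum_inv_pow_four_le_telescope {x : ℝ} (hx : 3 ≤ x) :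
    ((x + 1) ^ 4)⁻¹ ≤ 1 / 3 * (1 / (x * (x - 1) * (x - 2)) - 1 / ((x + 1) * (x + 1 - 1) * (x + 1 - 2))) := by
  have hx0 : x ≠ 0 := by positivity
  have hx1 : x - 1 ≠ 0 := by have : (0:ℝ) < x - 1 := by linarith
                             exact this.ne'
  have hx2 : x - 2 ≠ 0 := by have : (0:ℝ) < x - 2 := by linarith
                             exact this.ne'
  have hx3 : x + 1 ≠ 0 := by positivity
  have e1 : 1 / 3 * (1 / (x * (x - 1) * (x - 2)) - 1 / ((x + 1) * (x + 1 - 1) * (x + 1 - 2))) =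
      1 / ((x + 1) * x * (x - 1) * (x - 2)) := by
    rw [show x + 1 - 1 = x by ring, show x + 1 - 2 = x - 1 by ring]
    field_simp
    ring
  rw [e1, inv_eq_one_div]
  have hden : 0 < (x + 1) * x * (x - 1) * (x - 2) := by
    have : (0:ℝ) < x - 2 := by linarith
    have : (0:ℝ) < x - 1 := by linarith
    positivity
  apply one_div_le_one_div_of_le hden
  have h2 : (0:ℝ) ≤ x - 2 := by linarith
  nlinarith [mul_nonneg (mul_nonneg h2 h2) (mul_nonneg h2 h2), mul_nonneg (mul_nonneg h2 h2) h2]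

/-- Telescoping: `∑_{m=K+1}^{K'} 1/m⁴ ≤ (1/3)(1/(K(K-1)(K-2)) - 1/(K'(K'-1)(K'-2)))` for `K ≥ 3`.
[folklore] -/
theorem hcpSum_sum_Ioc_inv_pow_four_le {K K' : ℕ} (hK : 3 ≤ K) (h : K ≤ K') :
    ∑ m ∈ Finset.Ioc K K', ((m : ℝ) ^ 4)⁻¹ ≤
      1 / 3 * (1 / ((K : ℝ) * (K - 1) * (K - 2)) - 1 / ((K' : ℝ) * (K' - 1) * (K' - 2))) := by
  induction K', h using Nat.le_induction with
  | base => simp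
  | succ K' hKK' ih =>
    rw [Finset.sum_Ioc_succ_top hKK']
    have hK'3 : (3 : ℝ) ≤ K' := by exact_mod_cast (hK.trans hKK')
    have hstep := hcpSum_inv_pow_four_le_telescope hK'3
    push_cast
    linarith

/-- **Cube differences are below the tail bound**: for `e ≥ 3`, `K ≥ 4`, `c² ≥ 3/5` and every
`K' ≥ K`, `∑_{[-K',K']³ ∖ [-K,K]³} term ≤ T(e,K)`. [folklore] -/
theorem hcpSum_sum_sdiff_hcpSumCube_le {e : ℕ} (he : 3 ≤ e) {c : ℝ} (hc : 3 / 5 ≤ c ^ 2) {K K' : ℕ}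
    (hK : 4 ≤ K) (h : K ≤ K') :
    ∑ v ∈ hcpSumCube K' \ hcpSumCube K, hcpSumTerm e c v ≤ hcpSumTail e K := by
  -- first the telescopable form
  have main : ∑ v ∈ hcpSumCube K' \ hcpSumCube K, hcpSumTerm e c v ≤
      25 * (5 / 3 : ℝ) ^ e / ((K : ℝ) + 1) ^ (2 * e - 6) * ∑ m ∈ Finset.Ioc K K', ((m : ℝ) ^ 4)⁻¹ := by
    induction K', h using Nat.le_induction with
    | base => simp
    | succ K' hKK' ih =>
      have hsplit : hcpSumCube (K' + 1) \ hcpSumCube K =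
          (hcpSumCube (K' + 1) \ hcpSumCube K') ∪ (hcpSumCube K' \ hcpSumCube K) :=
        (Finset.sdiff_union_sdiff_cancel (hcpSumCube_mono (Nat.le_succ K')) (hcpSumCube_mono hKK')).symm
      have hdisj : Disjoint (hcpSumCube (K' + 1) \ hcpSumCube K') (hcpSumCube K' \ hcpSumCube K) :=
        Finset.disjoint_left.2 fun v h1 h2 => (Finset.mem_sdiff.1 h1).2 (Finset.mem_sdiff.1 h2).1
      rw [hsplit, Finset.sum_union hdisj, Finset.sum_Ioc_succ_top hKK', mul_add]
      have hshell := hcpSum_sum_shell_le (e := e) hc (m := K' + 1) (by omega)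
      rw [show K' + 1 - 1 = K' from rfl] at hshell
      have hsb := hcpSum_shell_bound_le (e := e) (K := K) (m := K' + 1) he (by omega) (by omega)
      push_cast at hshell hsb ⊢
      linarith
  refine main.trans ?_
  have htel := hcpSum_sum_Ioc_inv_pow_four_le (K := K) (K' := K') (by omega) h
  have hpos : 0 ≤ 25 * (5 / 3 : ℝ) ^ e / ((K : ℝ) + 1) ^ (2 * e - 6) := by positivity
  have hK3 : (3 : ℝ) ≤ K := by exact_mod_cast (show 3 ≤ K by omega)
  have hK'3 : (3 : ℝ) ≤ K' := by exact_mod_cast (show 3 ≤ K' by omega)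
  have hdrop : 1 / 3 * (1 / ((K : ℝ) * (K - 1) * (K - 2)) - 1 / ((K' : ℝ) * (K' - 1) * (K' - 2))) ≤
      1 / 3 / ((K : ℝ) * (K - 1) * (K - 2)) := by
    have : 0 ≤ 1 / ((K' : ℝ) * (K' - 1) * (K' - 2)) := by
      have : (0:ℝ) < K' - 2 := by linarith
      have : (0:ℝ) < K' - 1 := by linarith
      positivity
    have e1 : (1:ℝ) / 3 / ((K : ℝ) * (K - 1) * (K - 2)) = 1 / 3 * (1 / ((K : ℝ) * (K - 1) * (K - 2))) := by
      ring
    linarith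
  calc 25 * (5 / 3 : ℝ) ^ e / ((K : ℝ) + 1) ^ (2 * e - 6) * ∑ m ∈ Finset.Ioc K K', ((m : ℝ) ^ 4)⁻¹
      ≤ 25 * (5 / 3 : ℝ) ^ e / ((K : ℝ) + 1) ^ (2 * e - 6) * (1 / 3 / ((K : ℝ) * (K - 1) * (K - 2))) :=
        mul_le_mul_of_nonneg_left (htel.trans hdrop) hpos
    _ = hcpSumTail e K := by unfold hcpSumTail; ring

/-- Every finite index set lies in some cube. [folklore] -/
theorem hcpSum_exists_subset_hcpSumCube (s : Finset (ℤ × ℤ × ℤ)) (K₀ : ℕ) : ∃ K, K₀ ≤ K ∧ s ⊆ hcpSumCube K := by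
  classical
  refine ⟨max K₀ (s.sup fun v => (|v.1| ⊔ (|v.2.1| ⊔ |v.2.2|)).toNat), le_max_left _ _, ?_⟩
  intro v hv
  have hle : (|v.1| ⊔ (|v.2.1| ⊔ |v.2.2|)).toNat ≤ s.sup fun v => (|v.1| ⊔ (|v.2.1| ⊔ |v.2.2|)).toNat :=
    Finset.le_sup (f := fun v => (|v.1| ⊔ (|v.2.1| ⊔ |v.2.2|)).toNat) hv
  rw [hcpSum_mem_hcpSumCube]
  have h0 : |v.1| ⊔ (|v.2.1| ⊔ |v.2.2|) ≤ ((|v.1| ⊔ (|v.2.1| ⊔ |v.2.2|)).toNat : ℤ) := Int.self_le_toNat _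
  push_cast
  omega

/-- **Finite sums are bounded by cube + tail**: for `e ≥ 3`, `K ≥ 4`, `c² ≥ 3/5` and every finite
`s ⊆ ℤ³`, `∑_s term ≤ ∑_{[-K,K]³} term + T(e,K)`. [folklore] -/
theorem hcpSum_sum_le_cube_add_tail {e : ℕ} (he : 3 ≤ e) {c : ℝ} (hc : 3 / 5 ≤ c ^ 2) {K : ℕ} (hK : 4 ≤ K)
    (s : Finset (ℤ × ℤ × ℤ)) :
    ∑ v ∈ s, hcpSumTerm e c v ≤ ∑ v ∈ hcpSumCube K, hcpSumTerm e c v + hcpSumTail e K := by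
  obtain ⟨K', hKK', hs⟩ := hcpSum_exists_subset_hcpSumCube s K
  calc ∑ v ∈ s, hcpSumTerm e c v ≤ ∑ v ∈ hcpSumCube K', hcpSumTerm e c v :=
        Finset.sum_le_sum_of_subset_of_nonneg hs fun v _ _ => hcpSumTerm_nonneg e c v
    _ = ∑ v ∈ hcpSumCube K' \ hcpSumCube K, hcpSumTerm e c v + ∑ v ∈ hcpSumCube K, hcpSumTerm e c v :=
        (Finset.sum_sdiff (hcpSumCube_mono hKK')).symm
    _ ≤ hcpSumTail e K + ∑ v ∈ hcpSumCube K, hcpSumTerm e c v := by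
        have := hcpSum_sum_sdiff_hcpSumCube_le he hc hK hKK'
        linarith
    _ = _ := add_comm _ _

/-- **Summability** of the lattice sums `S e c` for `e ≥ 3`, `c² ≥ 3/5`. [folklore] -/
theorem hcpSumTerm_summable {e : ℕ} (he : 3 ≤ e) {c : ℝ} (hc : 3 / 5 ≤ c ^ 2) : Summable (hcpSumTerm e c) :=
  summable_of_sum_le (fun v => hcpSumTerm_nonneg e c v) (hcpSum_sum_le_cube_add_tail he hc (le_refl 4))

/-- **Upper bound**: `S e c ≤ ∑_{[-K,K]³} term + T(e,K)`. [folklore] -/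
theorem hcpSumS_le_cube_add_tail {e : ℕ} (he : 3 ≤ e) {c : ℝ} (hc : 3 / 5 ≤ c ^ 2) {K : ℕ} (hK : 4 ≤ K) :
    hcpSumS e c ≤ ∑ v ∈ hcpSumCube K, hcpSumTerm e c v + hcpSumTail e K :=
  Real.tsum_le_of_sum_le (fun v => hcpSumTerm_nonneg e c v) (hcpSum_sum_le_cube_add_tail he hc hK)

/-- **Lower bound**: `∑_{[-K,K]³} term ≤ S e c`. [folklore] -/
theorem hcpSum_cube_le_hcpSumS {e : ℕ} (he : 3 ≤ e) {c : ℝ} (hc : 3 / 5 ≤ c ^ 2) (K : ℕ) :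
    ∑ v ∈ hcpSumCube K, hcpSumTerm e c v ≤ hcpSumS e c :=
  (hcpSumTerm_summable he hc).sum_le_tsum (hcpSumCube K) fun v _ => hcpSumTerm_nonneg e c v

/-- **Monotonicity**: `S e` is antitone in `c` (for `c² ≥ 3/5`). [folklore] -/
theorem hcpSumS_antitone {e : ℕ} (he : 3 ≤ e) {c₁ c₂ : ℝ} (h₁ : 0 < c₁) (hc₁ : 3 / 5 ≤ c₁ ^ 2)
    (h₁₂ : c₁ ≤ c₂) : hcpSumS e c₂ ≤ hcpSumS e c₁ := by
  have hc₂ : 3 / 5 ≤ c₂ ^ 2 := hc₁.trans (pow_le_pow_left₀ h₁.le h₁₂ 2)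
  exact (hcpSumTerm_summable he hc₂).tsum_le_tsum (hcpSumTerm_antitone h₁ h₁₂) (hcpSumTerm_summable he hc₁)

/-- **Positivity**: `S e c ≥ 1 > 0` (the term at `v = (0,1,0)` equals `1`). [folklore] -/
theorem hcpSum_one_le_hcpSumS : ∀ {e : ℕ}, 3 ≤ e → ∀ {c : ℝ}, 3 / 5 ≤ c ^ 2 → 1 ≤ hcpSumS e c := by
  intro e he c hc
  have h1 : hcpSumTerm e c ((0 : ℤ), (1 : ℤ), (0 : ℤ)) = 1 := by
    unfold hcpSumTerm
    rw [if_neg (by decide), hcpSumQ_even (show Even (0 : ℤ) from ⟨0, rfl⟩)]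
    simp
  rw [← h1]
  exact (hcpSumTerm_summable he hc).le_tsum _ fun v _ => hcpSumTerm_nonneg e c v


end Summit.AtomisticToContinuum.Crystallization.Theorems.ExcessDecayLiouvilleCoarseGrains

end
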